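import Summits.BirchSwinnertonDyer.Rank1Residual.X11a.ChainHeightFree
import Literature.NumberTheory.EllipticCurves.HidaFamilyMembersMultiplicativeProofs
import Literature.NumberTheory.EllipticCurves.AnalyticRankModularityProofs
import HarnessLib

/-!
# Class X11a at a PRIME conductor: the chain of record with the Hida-family existence fact
# DISCHARGED (cell `b2b-bsdres`, unit `b2b-bsdres-x11a`, gen 19)

HONEST FRAMING (run/shared/lean/b2b/bsd-rank1-residual/, verbatim in every file): the goal of the
cell is to DELETE the COMBINATION-SHAPED residual classes of the Birch–Swinnerton-Dyer formula for
ALL analytic-rank `≤ 1` elliptic curves over `ℚ` — "full BSD formula for every rank `≤ 1` curve in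
class `C`" assembled STRICTLY from published theorems — so that the rank-`≤ 1` remainder becomes
exactly the CONSTRUCTION-SHAPED classes, which are TYPED (missing-input `Prop`s), NOT attempted.
This is not "finishing BSD". Research route; NO CLAIM BEYOND STATED CLASSES. Theorems only; every
published input is an explicit NAMED-FACT hypothesis; no new definition, no new fact.

WHAT. The X11a chain of record (`X11a/ChainBounded*.lean`: on X11a ∩ {`p ≥ 5`, `ρ̄_{E,p}`
surjective}, `MuAnZeroAt W p ⟹ BSD(E,p)` from 14 named published facts) has among its binders
`hHida : hida_exists_congruent_ordinary_newform_of_multiplicative` — step [L1], Hida 1986 /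
EPW 2006 Thm. 2.1.2–2.2.2: a GOOD-ordinary weight-`k` newform `g` of level EXACTLY `N/p` congruent
to `f_E`. Its classical layer (Deligne–Serre lift keeping `U_p` + "`p`-stabilisation backwards") is
now a tree THEOREM from modularity,
`exists_isNewform0_dvd_conductorNorm_div_congr_of_multiplicative_of_exists_isNewformOf`
(`Literature/…/HidaFamilyMembersMultiplicativeProofs.lean`, x11a gen 19): the member exists at SOME
level `M′ ∣ N/p`; only "`M′ = N/p`" is `Λ`-adic (constancy of the tame conductor / level raising).
At a curve of PRIME conductor `N = p` the quotient `N/p` is `1`, so `M′ = 1 = N/p` is forced and the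
named fact's conclusion HOLDS at the pair — `hida_member_of_conductorNorm_eq` below. Feeding it to
the chain (whose pair-level proof uses `hHida` only at the pair) gives:

* `Chain.invariantsAt_normLam_of_member_bdd` — harvest-2's `invariantsAt_normLam_of_facts_bdd`
  with the GLOBAL fact `hHida` replaced by the member existence AT THE PAIR (`hHidaW`; same proof,
  one line changed);
* `X11a.forall_bsdp_of_namedFacts_bdd_heightFree_of_conductorNorm_eq` — **on X11a ∩ {`N = p`
  prime, `p ≥ 5`, `ρ̄_{E,p}` surjective}: `MuAnZeroAt W p ⟹ BSD(E,p)` from 13 NAMED PUBLISHED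
  FACTS, NONE of them a Hida-family existence statement**: EPW Thm 3.1.1 / 1 / 5.1.3-bounded,
  Wan Thm 4 rational-bounded, Deligne–Serre 6.1, Hida/Wiles 3.26, Kato–Wuthrich A32, Stein–Wuthrich
  6.1 ×2, GZK, modularity as `exists_isNewformOf` (BCDT Thm. A; it also yields the chain's
  `hasEntireLFunction_rat` by the tree theorem `hasEntireLFunction_rat_of_exists_isNewformOf`) and
  `nonempty_modularParametrizationData`, Greenberg–Stevens; the MTT existence fact and the
  Stein–Wuthrich height facts being tree theorems / discharged at rank `0` as in the chain of record.
  (Example: `X₀(11)` at `p = 11`, EPW Ex. 5.3.1 — the weight-12 member is `Δ`.)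

Scope: a sub-family (prime conductor); elsewhere on X11a the binder `hHida` stays (exact level).
No label change by this file (cell lead / referee).

References: [EmertonPollackWeston2006] Thm. 2.1.2, §2.1, Ex. 5.3.1, Thm. 1, 3.1.1, 5.1.3;
[DeligneSerreASENS1974] 6.9–6.11; [Hida2022EMI] Cor. 4.1.30; [Wan2015] Thm. 4;
[SteinWuthrich2013] Thm. 6.1; [BreuilConradDiamondTaylor2001] Thm. A;
HOME/b2b-bsdres-x11a/REPORT-g19.md.
-/

noncomputable section

open scoped Classical MatrixGroups ModularForm

open CongruenceSubgroup WeierstrassCurve Literature.NumberTheory.EllipticCurves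
  Literature.NumberTheory.EllipticCurves.ModularForms
  Literature.NumberTheory.EllipticCurves.Rank1Residual
  Literature.NumberTheory.EllipticCurves.Rank1Residual.Typed
  Literature.NumberTheory.EllipticCurves.Wuthrich2014
  Literature.NumberTheory.EllipticCurves.SteinWuthrich2013
  Literature.NumberTheory.EllipticCurves.GreenbergVatsal2000
  Literature.NumberTheory.EllipticCurves.EmertonPollackWeston2006
  Literature.NumberTheory.EllipticCurves.BalakrishnanEtAl2019
  Summit.BirchSwinnertonDyer.Rank1Residual.X1.MuLambda
  Summit.BirchSwinnertonDyer.Rank1Residual.X11a.LambdaNorm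
  Summit.BirchSwinnertonDyer.Rank1Residual.RankZeroHeightFree

set_option autoImplicit false

/-! ### The Hida-family member at a curve of prime conductor (from modularity) -/

namespace Summit.BirchSwinnertonDyer.Rank1Residual.X11a

/-- **`hida_exists_congruent_ordinary_newform_of_multiplicative` AT a curve of PRIME conductor,
from the Modularity Theorem**: for `W/ℚ` globally minimal elliptic with `N = W.conductorNorm ℤ = p`,
`p ≥ 5` multiplicative, and every `k > 2` with `k ≡ 2 (mod p − 1)`, a newform
`g ∈ S_k(Γ₀(N/p)) = S_k(SL₂(ℤ))` and `ι : K_g →+* ℚ̄_p` with `|ι a_p(g)|_p = 1` and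
`|ι a_ℓ(g) − a_ℓ(E)|_p < 1` for all primes `ℓ ∤ N`: the level `M′ ∣ N/p = 1` of the member given by
`exists_isNewform0_dvd_conductorNorm_div_congr_of_multiplicative_of_exists_isNewformOf` is forced to
be `N/p`. (EPW Ex. 5.3.1: `X₀(11)`, `p = 11`, `f₁₂ =` the `11`-stabilised `Δ`.)
[cite: EmertonPollackWeston2006, Thm. 2.1.2, §2.1 (arXiv:math/0404484 p. 7) and Ex. 5.3.1 (p. 32)]
[cite: DeligneSerreASENS1974, 6.9–6.11] [cite: BreuilConradDiamondTaylor2001, Thm. A] -/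
theorem hida_member_of_conductorNorm_eq (hmod : exists_isNewformOf)
    (W : WeierstrassCurve ℚ) [W.IsElliptic] [W.IsGloballyMinimal] (p : ℕ) [Fact p.Prime]
    (hp5 : 5 ≤ p) (hmult : W.HasMultiplicativeReductionAtPrime p) (hN : W.conductorNorm ℤ = p)
    [NeZero (W.conductorNorm ℤ / p)] (k : ℤ) (hk : 2 < k) (hpk : ((p : ℤ) - 1) ∣ (k - 2)) :
    ∃ (g : CuspForm (Gamma0 (W.conductorNorm ℤ / p)) k) (ι : coeffField g →+* PadicAlgCl p),
      IsNewform0 g ∧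
      ‖ι ⟨(UpperHalfPlane.qExpansion 1 ⇑g).coeff p, coeff_mem_coeffField g p⟩‖ = 1 ∧
      ∀ ℓ : ℕ, ℓ.Prime → ¬ ℓ ∣ W.conductorNorm ℤ →
        ‖ι ⟨(UpperHalfPlane.qExpansion 1 ⇑g).coeff ℓ, coeff_mem_coeffField g ℓ⟩
            - ((W.frobeniusTrace ℓ : ℤ) : PadicAlgCl p)‖ < 1 := by
  obtain ⟨M, _, hM, g, ι, hg, hap, hcong⟩ :=
    exists_isNewform0_dvd_conductorNorm_div_congr_of_multiplicative_of_exists_isNewformOf hmod W p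
      hp5 hmult k hk hpk
  have h1 : W.conductorNorm ℤ / p = 1 := by rw [hN, Nat.div_self (Fact.out : p.Prime).pos]
  have hM1 : M = W.conductorNorm ℤ / p := by
    rw [h1] at hM ⊢
    exact Nat.dvd_one.mp hM
  subst hM1
  exact ⟨g, ι, hg, hap, hcong⟩

end Summit.BirchSwinnertonDyer.Rank1Residual.X11a

namespace Summit.BirchSwinnertonDyer.Rank1Residual.X11a.Chain

/-! ### The pair-level chain with the member existence AT THE PAIR -/

section Member

variable (W : WeierstrassCurve ℚ) [W.IsElliptic] [W.IsGloballyMinimal] (p : ℕ) [Fact p.Prime]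

/-- **The chain at a pair on the BOUNDED Wan / EPW facts, with the Hida-family member supplied AT
THE PAIR** (`hHidaW`: for every admissible weight a good-ordinary newform of level `N/p` congruent
to `f_E` — the body of `hida_exists_congruent_ordinary_newform_of_multiplicative` at `(W, p)`)
instead of the global named fact: harvest-2's `invariantsAt_normLam_of_facts_bdd` uses `hHida`
only there; same proof, one line changed. [cite: EmertonPollackWeston2006, Thm. 1, Thm. 3.1.1, Thm. 5.1.3]
[cite: Wan2015, Thm. 4 (pp. 4–5) = Thm. 103 (pp. 91–92)] -/
theorem invariantsAt_normLam_of_member_bdd [NeZero (W.conductorNorm ℤ / p)]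
    (hHidaW : ∀ (k : ℤ), 2 < k → ((p : ℤ) - 1) ∣ (k - 2) →
      ∃ (g : CuspForm (Gamma0 (W.conductorNorm ℤ / p)) k) (ι : coeffField g →+* PadicAlgCl p),
        IsNewform0 g ∧
        ‖ι ⟨(UpperHalfPlane.qExpansion 1 ⇑g).coeff p, coeff_mem_coeffField g p⟩‖ = 1 ∧
        ∀ ℓ : ℕ, ℓ.Prime → ¬ ℓ ∣ W.conductorNorm ℤ →
          ‖ι ⟨(UpperHalfPlane.qExpansion 1 ⇑g).coeff ℓ, coeff_mem_coeffField g ℓ⟩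
              - ((W.frobeniusTrace ℓ : ℤ) : PadicAlgCl p)‖ < 1)
    (hMTT : exists_isCycPAdicLFunctionWeightK)
    (h311 : thm311_cotorsion_weightK_member) (hT1a : thm1_muAlg_of_weightK_member)
    (hT2 : Wan2015.thm4_rational_weightK_member_of_bdd)
    (hT1b : thm513_transfer_from_weightK_member_of_bdd)
    (hKato : kato_charIdeal_dvd_multiplicative_of_surjective)
    (hpar : nonempty_modularParametrizationData)
    (hData : ∀ {k : ℤ} (g : CuspForm (Gamma0 (W.conductorNorm ℤ / p)) k)
      (ι : coeffField g →+* PadicAlgCl p), IsOrdinaryMemberOf W p g ι →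
      Nonempty (OrdinaryPadicData g p ι))
    (hDual : ∀ {k : ℤ} (g : CuspForm (Gamma0 (W.conductorNorm ℤ / p)) k)
      (ι : coeffField g →+* PadicAlgCl p), IsOrdinaryMemberOf W p g ι →
      ∀ (𝔇 : OrdinaryPadicData g p ι) (κ : ZpExtension ℚ p)
      (γ : Field.absoluteGaloisGroup ℚ), κ.IsCyclotomic → κ.IsTopGenerator γ →
      Nonempty (GreenbergSelmer.DualData (padicCoeffField (memberGenerators g ι 𝔇.υ)) κ γ 𝔇.ρ 𝔇.plus))
    (hGen : ∀ {k : ℤ} (g : CuspForm (Gamma0 (W.conductorNorm ℤ / p)) k)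
      (ι : coeffField g →+* PadicAlgCl p), IsOrdinaryMemberOf W p g ι →
      ∀ (𝔇 : OrdinaryPadicData g p ι) (κ : ZpExtension ℚ p)
      (γ : Field.absoluteGaloisGroup ℚ), κ.IsCyclotomic → κ.IsTopGenerator γ →
      ∀ (D : GreenbergSelmer.DualData (padicCoeffField (memberGenerators g ι 𝔇.υ)) κ γ 𝔇.ρ 𝔇.plus),
      Module.Finite (PowerSeries (padicCoeffIntegers (memberGenerators g ι 𝔇.υ))) D.X →
      Module.IsTorsion (PowerSeries (padicCoeffIntegers (memberGenerators g ι 𝔇.υ))) D.X →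
      ∃ G, D.charIdeal = Ideal.span {G})
    (hp : 5 ≤ p) (hmult : W.HasMultiplicativeReductionAtPrime p)
    (hsurj : W.HasSurjectiveModNGaloisRep p) (hμ : MuAnZeroAt W p) :
    InvariantsAt W p fun gK fE => HasUnitContent gK ∧ HasUnitContent fE ∧ normLam gK = normLam fE := by
  -- adapted from `invariantsAt_normLam_of_facts_bdd` (X11a/ChainBounded.lean, harvest-2 gen 24)
  have hprime : p.Prime := Fact.out
  have hp2 : p ≠ 2 := by omega
  haveI : NeZero p := ⟨hprime.ne_zero⟩
  have hirr : W.HasIrreducibleModPGaloisRep p :=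
    hasIrreducibleModPGaloisRep_of_hasSurjectiveModNGaloisRep W p hsurj
  have hpM : ¬ p ∣ W.conductorNorm ℤ / p := not_dvd_conductorNorm_div W p hmult
  -- [L1]: the weight-`k` member, `k = (p − 1) + 2`
  set n : ℕ := p - 1 with hn
  have hn0 : n ≠ 0 := by omega
  have hneven : Even n := hn ▸ hprime.even_sub_one hp2
  have hk2 : (2 : ℤ) < (n : ℤ) + 2 := by omega
  have hkdvd : ((p : ℤ) - 1) ∣ ((n : ℤ) + 2 - 2) := by
    refine ⟨1, ?_⟩
    rw [hn, Nat.cast_sub hprime.one_le]; push_cast; ring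
  obtain ⟨g, ι, hg, hap, hcong⟩ := hHidaW ((n : ℤ) + 2) hk2 hkdvd
  have hmem : IsOrdinaryMemberOf W p g ι := ⟨hk2, hkdvd, hg, hap, hcong⟩
  -- (E1) the ordinary `p`-adic data; Shimura's datum; THE `p`-adic `L`-function
  obtain ⟨𝔇⟩ := hData g ι hmem
  obtain ⟨Dsym⟩ := IsNewform0.nonempty_periodSymbolDatum hneven hn0 hg
  -- keep the BOUNDEDNESS clause of the MTT fact: the uniqueness class of THE `p`-adic `L`-function,
  -- the extra binder of the corrected facts `…_of_bdd` (the original proof discarded it)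
  obtain ⟨L, hL, hbd, -⟩ := hMTT g hg (by omega) p hpM ι 𝔇.υ 𝔇.υ_root 𝔇.norm_υ Dsym
  -- [L4]: `μ(X(E/ℚ_∞)) = 0` for every cyclotomic / dual datum, from the certificate
  have hμalg : ∀ (κ : ZpExtension ℚ p) (γ : Field.absoluteGaloisGroup ℚ), κ.IsCyclotomic →
      κ.IsTopGenerator γ → IsCyclotomicVariable p γ →
      ∀ D' : W.SelmerDualData κ γ, D'.IsTorsion ∧ D'.mu = 0 :=
    fun κ γ hκ hγ hγ' D' =>
      ⟨(isTorsion_and_exists_generator_hasUnitContent_of_muAnZeroAt W p hKato hpar hp hmult hsurj hμ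
          hκ hγ hγ' D').1,
        selmerDual_mu_eq_zero_of_muAnZeroAt W p hKato hpar hp hmult hsurj hμ hκ hγ hγ' D'⟩
  -- the conclusion's own cyclotomic datum serves the `g`-side
  intro κ γ hκ hγ hγ' N _ f hf D' ϖ hϖ fE gK hchar
  obtain ⟨D⟩ := hDual g ι hmem 𝔇 κ γ hκ hγ
  obtain ⟨hfin, htors⟩ := h311 W p hp hmult hirr g ι hmem 𝔇 κ γ hκ hγ D
  obtain ⟨G, hG⟩ := hGen g ι hmem 𝔇 κ γ hκ hγ D hfin htors
  -- EPW Thm. 1 (alg): `μ^alg(g) = 0`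
  have hμg := hT1a W p hp hmult hirr hμalg g ι hmem 𝔇 κ γ hκ hγ hγ' D htors G hG
  -- Wan Thm. 4: `L = c · u · G`, hence `λ^alg(g) = λ^an(g)`
  obtain ⟨c, u, hc, hLcuG⟩ :=
    hT2 W p hp hmult hsurj hpM g ι hmem 𝔇 κ γ hκ hγ hγ' D htors G hG Dsym L hL hbd
  have hlam : normLam (PowerSeries.map (padicCoeffIntegers (memberGenerators g ι 𝔇.υ)).subtype G) =
      normLam L := by
    obtain ⟨hU0, hU⟩ := map_unit_integral u
    obtain ⟨hGmax, hG0⟩ := hasMaxCoeff_map_of_exists_norm_eq_one hμg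
    rw [hLcuG, normLam_C_mul (norm_ne_zero_iff.mpr hc), map_mul,
      normLam_mul_of_integral_unit hU0 hU hGmax hG0]
  -- EPW Thm. 5.1.3 (+ 4.4.5 with the certificate), at the Kato pair
  exact hT1b W p hp hmult hirr g ι hmem 𝔇 κ γ hκ hγ hγ' D htors G hG Dsym L hL hbd hμg hlam hμ κ γ hκ
    hγ hγ' f hf D' ϖ hϖ fE gK hchar

end Member

end Summit.BirchSwinnertonDyer.Rank1Residual.X11a.Chain

/-! ### Class level: X11a at a prime conductor, no Hida-family existence fact -/

namespace Summit.BirchSwinnertonDyer.Rank1Residual.X11a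

open Chain

/-- **X11a ∩ {`N = p` prime, `p ≥ 5`, `ρ̄_{E,p}` surjective}: `BSD(E,p)` ⇐ 13 NAMED PUBLISHED FACTS
+ the per-pair certificate `μ^an(E,p) = 0`, NONE of the 13 a Hida-family existence statement** —
the chain of record (`forall_bsdp_of_namedFacts_bdd_mtt_heightFree`, 14 facts) with `hHida`
DISCHARGED at prime conductor by `hida_member_of_conductorNorm_eq` (modularity `hNf :
exists_isNewformOf`, which also supplies `hasEntireLFunction_rat` through the tree theorem
`hasEntireLFunction_rat_of_exists_isNewformOf`). The 13: EPW 2006 Thm 3.1.1 / Thm 1 / Thm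
5.1.3-bounded (`h311`, `hT1a`, `hT1b`), Wan 2015 Thm 4 rational-bounded (`hT2`), Deligne–Serre 6.1
(`h61`), Hida/Wiles 3.26 (`h326`), Kato–Wuthrich A32 (`hKato`), Stein–Wuthrich Thm 6.1 ×2 (`hJs`,
`hJn`), GZK (`hGZK`), modularity (`hNf`, `hpar`), Greenberg–Stevens (`hGS`); the existence inputs
(E1)–(E3) and the MTT existence fact are tree theorems, the Stein–Wuthrich height facts are
discharged at rank `0` (gen 18). Class-level residue unchanged (Greenberg's `μ`-conjecture, typed
`X11a.MuAnZeroAt`). No label change. [cite: EmertonPollackWeston2006, Thm. 1, Thm. 3.1.1, Thm. 5.1.3, §2.1 and Ex. 5.3.1]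
[cite: Wan2015, Thm. 4 (pp. 4–5) = Thm. 103 (pp. 91–92)] [cite: SteinWuthrich2013, Thm. 6.1 (p. 20)]
[cite: BreuilConradDiamondTaylor2001, Thm. A] -/
theorem forall_bsdp_of_namedFacts_bdd_heightFree_of_conductorNorm_eq
    (hNf : exists_isNewformOf)
    (h311 : thm311_cotorsion_weightK_member) (hT1a : thm1_muAlg_of_weightK_member)
    (hT2 : Wan2015.thm4_rational_weightK_member_of_bdd)
    (hT1b : thm513_transfer_from_weightK_member_of_bdd)
    (h61 : DeligneSerre1974.thm61_exists_adicGaloisRep) (h326 : Hida2000_thm326_ordinary)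
    (hKato : kato_charIdeal_dvd_multiplicative_of_surjective)
    (hJs : thm61_splitMultiplicative) (hJn : thm61_nonsplitMultiplicative)
    (hGZK : rank_eq_analyticRank_of_analyticRank_le_one)
    (hpar : nonempty_modularParametrizationData)
    (hGS : ∀ (W : WeierstrassCurve ℚ) [W.IsElliptic] [W.IsGloballyMinimal] (p : ℕ) [Fact p.Prime],
      greenberg_stevens (W := W) (p := p)) :
    ∀ (W : WeierstrassCurve ℚ) [W.IsElliptic] [W.IsGloballyMinimal] (p : ℕ) [Fact p.Prime],
      ClassX11a W p → 5 ≤ p → Surj W p → W.conductorNorm ℤ = p → MuAnZeroAt W p → BSDp W p := by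
  intro W _ _ p _ hX hp hsurj hN hμ
  haveI : NeZero (W.conductorNorm ℤ / p) := neZero_conductorNorm_div W p hX.2.2.1
  haveI : NeZero p := ⟨(Fact.out : p.Prime).ne_zero⟩
  have hmult : W.HasMultiplicativeReductionAtPrime p := hX.2.2.1
  have hirr : W.HasIrreducibleModPGaloisRep p :=
    hasIrreducibleModPGaloisRep_of_hasSurjectiveModNGaloisRep W p hsurj
  have hmod : hasEntireLFunction_rat := hasEntireLFunction_rat_of_exists_isNewformOf hNf
  have hinv := invariantsAt_normLam_of_member_bdd W p
    (fun k hk hpk ↦ hida_member_of_conductorNorm_eq hNf W p hp hmult hN k hk hpk)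
    exists_isCycPAdicLFunctionWeightK_holds h311 hT1a hT2 hT1b hKato hpar
    (fun g ι hmem =>
      exists_ordinaryPadicData_weightK_member_of_thm61_of_thm326 h61 h326 W p hp hmult hirr g ι hmem)
    (fun g ι hmem 𝔇 κ γ hκ hγ =>
      GreenbergSelmer.exists_dualData_weightK_member_unconditional W p hp hmult hirr g ι hmem 𝔇 κ γ
        hκ hγ)
    (fun g ι hmem 𝔇 κ γ hκ hγ D hfin htors =>
      (charIdeal_isPrincipal_weightK_member_unconditional W p hp hmult hirr g ι hmem 𝔇 κ γ hκ hγ D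
        hfin htors).principal)
    hp hmult hsurj hμ
  exact bsdp_of_invariantsMatchAt_heightFree W p hKato hJs hJn hGZK hmod hpar (hGS W p) hp hmult
    hsurj hX.1 (invariantsMatchAt_of_invariantsAt_normLam W p hinv)

/-- **X11a ∩ {`N = p` prime, `p ≥ 11`}: `BSD(E,p)` ⇐ 14 NAMED PUBLISHED FACTS + the per-pair
certificate, with NO hypothesis on the image of `ρ̄_{E,p}` and NO Hida-family existence fact**
(`Surj` from BDMTV 2019 Thm. 1.2, `hB`, via x11c's `ClassX11a.surj_of_eleven_le`; every prime
conductor is `≥ 11`, so this is the whole prime-conductor sub-family of X11a).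
[cite: BalakrishnanEtAl2019, §1 Thm. 1.2 (arXiv:1711.05846 p. 2)]
[cite: EmertonPollackWeston2006, Thm. 1, Thm. 3.1.1, Thm. 5.1.3, §2.1 and Ex. 5.3.1]
[cite: BreuilConradDiamondTaylor2001, Thm. A] -/
theorem forall_bsdp_of_namedFacts_bdd_heightFree_of_conductorNorm_eq_of_eleven_le
    (hNf : exists_isNewformOf)
    (h311 : thm311_cotorsion_weightK_member) (hT1a : thm1_muAlg_of_weightK_member)
    (hT2 : Wan2015.thm4_rational_weightK_member_of_bdd)
    (hT1b : thm513_transfer_from_weightK_member_of_bdd)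
    (h61 : DeligneSerre1974.thm61_exists_adicGaloisRep) (h326 : Hida2000_thm326_ordinary)
    (hKato : kato_charIdeal_dvd_multiplicative_of_surjective)
    (hJs : thm61_splitMultiplicative) (hJn : thm61_nonsplitMultiplicative)
    (hGZK : rank_eq_analyticRank_of_analyticRank_le_one)
    (hpar : nonempty_modularParametrizationData)
    (hGS : ∀ (W : WeierstrassCurve ℚ) [W.IsElliptic] [W.IsGloballyMinimal] (p : ℕ) [Fact p.Prime],
      greenberg_stevens (W := W) (p := p))
    (hB : thm12_not_le_normalizer_splitCartan) :
    ∀ (W : WeierstrassCurve ℚ) [W.IsElliptic] [W.IsGloballyMinimal] (p : ℕ) [Fact p.Prime],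
      ClassX11a W p → 11 ≤ p → W.conductorNorm ℤ = p → MuAnZeroAt W p → BSDp W p := by
  intro W _ _ p _ hX h11 hN hμ
  exact forall_bsdp_of_namedFacts_bdd_heightFree_of_conductorNorm_eq hNf h311 hT1a hT2 hT1b h61 h326
    hKato hJs hJn hGZK hpar hGS W p hX (by omega) (ClassX11a.surj_of_eleven_le W p hB hX h11) hN hμ

end Summit.BirchSwinnertonDyer.Rank1Residual.X11a

end
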